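import Mathlib
import HarnessLib
import HarnessLib.Audit
import Summits.AtomisticToContinuum.Statement
import Literature.MathematicalPhysics.StatisticalMechanics.LennardJonesClusters
import Literature.MathematicalPhysics.StatisticalMechanics.BarlowStacking
import Literature.MathematicalPhysics.StatisticalMechanics.LennardJonesThermodynamicLimitProofs
import Summits.AtomisticToContinuum.Crystallization.Theorems.PalmUnimodularRigidityCrysPeriodicBddBelow
import Summits.AtomisticToContinuum.Crystallization.Theorems.ThreeConeCertificateDefectVanishCrystallizes
import Summits.AtomisticToContinuum.Crystallization.Theorems.PricedLinkCensusCrysEnergyUpper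
import HarnessLib.Audit.Status.Attr

/-!
Route: PRVarianceCertificate

# Route PRVarianceCertificate — scale out the length, transfer in the Cauchy–Schwarz denominator —
the variance-form certificate Σs² ≤ Φ(hcp)·Σt decides (i), its defect-counting deficit decides (ii)

Write s_i = Σ_{j≠i} r_ij⁻⁶ and t_i = Σ_{j≠i} r_ij⁻¹² for a finite configuration (Lean: `siteEnergy
(fun r => (r⁻¹)^6)`,
`siteEnergy (fun r => (r⁻¹)^12)`). Optimising the dilation of V_LJ = r⁻¹²/12 − r⁻⁶/6 gives E(x) ≥
−(Σ_i s_i)²/(24 Σ_i t_i) for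
every x (the identity −12E(N) = sup PR of card participation-ratio-constant), and weighted
Cauchy–Schwarz with free weights
τ_i, Στ_i = Σt_i (card pr-denominator-transfer-certificate: "transfer in the denominator") shows
that a local transfer rule
exists for x iff the VARIANCE-FORM CERTIFICATE Σ_i s_i² ≤ Φ*·Σ_i t_i holds. It suffices to show X =
CoerciveVarianceCertificate:
there are a periodic configuration P of ℝ³ (intended: relaxed hcp) and C > 0 with e_LJ(P) ≤ −C/24
such that for every R, ε > 0
some c(R,ε) > 0 makes, for every Lennard-Jones ground state x of N ≥ 2 particles, the deficit C·Σ_i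
t_i − Σ_i s_i² at least c times
the number of particles whose R-neighbourhood is not ε-congruent (by a linear isometry) to a window
of P. Its c = 0 core
GroundStateVarianceCertificate (rank 2) alone gives conjunct (i) with the minimiser P exhibited and
E(N) ≥ N·e(P) for every N;
the counting form feeds the shared hinge BulkDefectVanish and hence conjunct (ii). Gen-2 re-opening
of retired route
PRDenominatorTransfer (same mechanism, now with a proved deciding theorem and the (ii)-side carried
by the certificate itself).
Lean: `∃ (P : Literature.MathematicalPhysics.StatisticalMechanics.PeriodicConfiguration 3) (C : ℝ),
0 < C ∧ P.energyPerParticle Literature.MathematicalPhysics.StatisticalMechanics.lennardJones ≤ -(C /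
24) ∧ ∀ R ε : ℝ, 0 < R → 0 < ε → ∃ c : ℝ, 0 < c ∧ ∀ (N : ℕ) (x : Fin N → EuclideanSpace ℝ (Fin 3)),
Literature.MathematicalPhysics.StatisticalMechanics.IsGroundState
Literature.MathematicalPhysics.StatisticalMechanics.lennardJones x → 2 ≤ N → c * (Nat.card {i : Fin
N // ¬ ∃ A : EuclideanSpace ℝ (Fin 3) →ₗᵢ[ℝ] EuclideanSpace ℝ (Fin 3), (∀ p ∈ P.points, ‖p‖ ≤ R → ∃
j : Fin N, dist (x j) (x i + A p) ≤ ε) ∧ (∀ j : Fin N, dist (x j) (x i) ≤ R → ∃ p ∈ P.points, dist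
(x j) (x i + A p) ≤ ε)} : ℝ) ≤ C * ∑ i,
Literature.MathematicalPhysics.StatisticalMechanics.siteEnergy (fun r => (r⁻¹) ^ 12) x i - ∑ i,
(Literature.MathematicalPhysics.StatisticalMechanics.siteEnergy (fun r => (r⁻¹) ^ 6) x i) ^ 2`

## Assembly
Deciding theorem (glue.lean, PROVED sorry-free in Sketch.lean against `_root_.Crystallization` with
all twelve items as hypotheses,
axioms propext / Classical.choice / Quot.sound): conjunct (ii) is `DefectVanishCrystallizes
(CoerciveToDefectVanish CoerciveVarianceCertificate
CrysEnergyUpper CrysPeriodicBddBelow) LennardJonesMinimalDistance_holds`; conjunct (i): from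
GroundStateVarianceCertificate take P, C;
LennardJonesGroundStatesExist_holds (proved) gives ground states x_N, CertificateBoundsEnergy gives
E(N) = 𝓔(x_N) ≥ −(C/24)N ≥ N·e(P),
so e(P) ≤ E(N)/N for N ≥ 1; BlancLewin2015_8_holds (proved) gives E(N)/N → e, hence e(P) ≤ e
(ge_of_tendsto); CrysEnergyUpper with
Tendsto.limsup_eq gives e ≤ ⨅_Q e(Q) ≤ e(P) (ciInf_le, CrysPeriodicBddBelow), so e = e(P) = ⨅_Q
e(Q): IsLeast at P and E(N)/N → e(P),
i.e. HasPeriodicGroundStateEnergy lennardJones 3. Standard reductions only; VarianceCertificate,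
PlanarVarianceCertificate,
LatticeQuotientBound are rungs/slices not consumed by the deciding theorem (VarianceCertificate ⇒
crux 2, checked in Sketch.lean).

Rationale: WHY THIS LINE. For the two-term homogeneous potential the dilation trick (LennardJonesIngham1925,
KiharaKoba1952 for lattices; one line for all
finite configurations) makes the ground-state constant a dimensionless participation ratio, and the
method of parameters (free
Cauchy–Schwarz weights moved by a discharging-style transfer, Hales2012) turns the per-site
conjecture into a summable certificate whose
weight-free form is exactly Σ_i s_i² ≤ Φ*Σ_i t_i, with Ψ := Σs²/Σt = 2PR/N + Var(s)/mean(t):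
crowding is self-penalising (t ∝ r⁻¹²),
equality at hcp is automatic by vertex-transitivity, and no minimal-distance input, bond tolerance
or boundary term appears — this is
what separates it from the one-centre stability bounds in print (Blanc2004, Yuhjtman2015: 14.316 vs
8.61, KiesslingWales2025) and from
every other route of this sub (energy-valued, dimensionful certificates). New in gen-2: the DEFICIT
Φ*Σt − Σs² is itself the defect
functional — by the same algebra E(N) − N·e(P) ≥ N·deficit/(24Σt), so a coercive certificate plus
the trial-state upper bound forces
o(N) unmatched sites (BulkDefectVanish, shared with PoissonBesselStacking / LuttingerTiszaRegistry)
and the soft assembly lemma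
DefectVanishCrystallizes gives Blanc–Lewin (ii); imported areas: inequalities
(Hardy–Littlewood–Pólya ch. IX weights), discharging
(Flyspeck), lattice-sum energetics (BeterminSamajTravenec2022, Betermin2023, arXiv:2605.07580).
Negatives index (6 entries, 2 in this
sub: effective local Hales 4146, one-grain gluing 3506) is not touched: no shell-pattern inference
and no grain gluing is asserted.

RANKED CRUXES. #2 GroundStateVarianceCertificate (crux) — there are a periodic configuration P of ℝ³
and C > 0 with e_LJ(P) ≤ −C/24 such that every Lennard-Jones ground state x of N particles satisfies
Σ_i s_i(x)² ≤ C·Σ_i t_i(x) (card item X_G in its logically equivalent weight-free form; intended P =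
relaxed hcp, C = Φ(hcp) = L₆²/L₁₂ ≈ 17.222; forces e(P) = −C/24 = min over periodic configurations
and E(N) ≥ N·e(P) for every N). [difficulty: open-problem] (why it might fail: Ψ = 2PR/N +
Var(s)/mean(t) is stronger than (i) by the site-variance term: a ground-state family whose variance
beats its PR deficit (phonon margin only 0.29; a non-vertex-transitive periodic minimiser) refutes
it even if hcp is the LJ crystal.) [Yuhjtman2015, BlancLewin2015, LennardJonesIngham1925,
Stillinger2001, BeterminSamajTravenec2022,
Literature.Barriers.AtomisticToContinuum.TetrahedralFrustration]
#3 CoerciveVarianceCertificate (crux) — the coercive (defect-counting) form, = X of the thesis: ∃ P,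
C > 0 with e_LJ(P) ≤ −C/24 such that ∀ R, ε > 0 ∃ c > 0: for every LJ ground state x of N ≥ 2
particles, c·#{i : no linear isometry A makes the particles of B_R(x_i) ε-match x_i + A(P.points ∩
B_R) both ways} ≤ C·Σ_i t_i − Σ_i s_i² (the matching predicate is verbatim that of the shared hinge
BulkDefectVanish, item 0751; card item (4) 'strictness'). [deps: GroundStateVarianceCertificate]
[difficulty: open-problem] (why it might fail: needs uniqueness of the periodic minimiser up to
isometry AND a uniform rate: unmatched sites with zero local deficit (uniformly strained grains,
scale drift — Ψ is dilation-blind; sites within R of the surface when N ≲ ρR³) must be paid by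
distant deficit with one c(R,ε) for all N.) [BlancLewin2015, Hales2012, FlatleyTheil2015,
PartayOrtnerCsanyi2017, Stillinger2001,
Literature.Barriers.AtomisticToContinuum.KissingTwelveDegeneracy,
Literature.Barriers.AtomisticToContinuum.ShortRangeStackingBlindness]
#4 VarianceCertificate (crux) — the same certificate for EVERY finite configuration of distinct
points of ℝ³ (scale-free, no minimal-distance or ground-state input): ∃ P, C > 0, e_LJ(P) ≤ −C/24 ∧
∀ injective x, Σ_i s_i² ≤ C·Σ_i t_i; equivalently sup_X Σs²/Σt is attained, in the limit, by a
periodic configuration. This is the natural target of a local isometry-equivariant transfer rule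
(the rule cannot see whether x is a ground state) and implies crux 2 trivially. [difficulty:
open-problem] (why it might fail: adding far 'halo' points raises Ψ (marginal ratio ≈ s̄·r⁶ ≫ Φ*):
an engineered multi-scale configuration (hovering shells at r ≈ 1.2, interfaces of two densities)
might push Σs²/Σt above Φ(hcp) though no ground state does; refuter halo tests recovered ≤ 20 % of
the surface deficit.) [LennardJonesIngham1925, KiharaKoba1952, Yuhjtman2015, BlancLewin2015,
Literature.Barriers.AtomisticToContinuum.IcosahedralClusters]
#5 PlanarVarianceCertificate (crux) — the planar rung: ∃ P : PeriodicConfiguration 2 (intended: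
triangular lattice, Φ_tri = L₆²/L₁₂ = 6.3759²/6.0098 = 6.7642), C > 0, e_LJ(P) ≤ −C/24 ∧ ∀ finite
injective x ⊂ ℝ², Σ_i s_i² ≤ C·Σ_i t_i. Gives conjunct (i) for the TRUE (12,6) potential in d = 2
(outside Theil2006's hypotheses); the Bravais slice is BeterminZhang2015; the hexagon is a rigid
kissing configuration, so this is where a transfer-free or one-transfer proof should exist if the
mechanism is real. [difficulty: L] (why it might fail: same variance strengthening in d = 2
(long-wave phonon ratio Var/deficit = 2/3, margin 1/3); triangular patches give Ψ = 6.56 at N = 931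
(refuter) vs Φ_tri = 6.764 and halos add +0.02: a large decorated cluster could still cross Φ_tri.)
[Theil2006, BeterminZhang2015, Betermin2023, arXiv:2605.07580, BlancLewin2015,
Literature.Barriers.AtomisticToContinuum.LocalizedPotentialsExcludeLennardJones]
#6 LatticeQuotientBound (crux) — the variance-free Bravais slice, pinned to hcp: there are a, h ≠ 0
such that for every Bravais lattice L of ℝ³ (periodic configuration with one-point motif) L₆(L)² ≤
(−24·e_LJ(hcp_{a,h}))·L₁₂(L), i.e. no Bravais lattice at any density beats relaxed hcp for
Lennard-Jones (expected max_L L₆²/L₁₂ = Φ(fcc) = 17.2204 < 17.2222 = Φ(hcp); certified lattice sums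
+ a 5-parameter optimisation over lattice shapes with cusp asymptotics, the ratio analogue of
Betermin2023 / arXiv:2605.07580 one dimension up). [difficulty: M] (why it might fail: asserts two
numerically-known but unproved facts at once: fcc maximises L₆²/L₁₂ among 3-D Bravais lattices
(BeterminSamajTravenec2022 numerics) and hcp beats fcc (Φ 17.2222 vs 17.2204, relative margin
1.0e-4, Stillinger2001); a non-cubic lattice inside that margin kills it.)
[BeterminSamajTravenec2022, Stillinger2001, SchwerdtfegerBurrowsSmits2021, KiharaKoba1952,
arXiv:2212.10727, Literature.Barriers.AtomisticToContinuum.NoUniversallyOptimalLattice3D,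
Literature.Barriers.AtomisticToContinuum.HcpNotBravais]
#9 CertificateBoundsEnergy (support) — Cauchy–Schwarz + dilation, pure algebra in any dimension: if
0 ≤ C and Σ_i s_i² ≤ C·Σ_i t_i for an injective configuration x of N points, then interactionEnergy
lennardJones x ≥ −(C/24)·N (with A = Σ_{i<j} r⁻⁶ = ½Σs_i, B = Σ_{i<j} r⁻¹² = ½Σt_i: E = B/12 − A/6 =
(B − A)²/(12B) − A²/(12B) ≥ −A²/(12B) and (Σs_i)² ≤ N·Σs_i² ≤ N·C·Σt_i; N ≤ 1 is 0 ≤ 0;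
two_mul_interactionEnergy in tree). [difficulty: provable-now] [LennardJonesIngham1925,
BlancLewin2015]
#9 CrysEnergyUpper (support) — trial-state upper bound limsup E(N)/N ≤ ⨅ over periodic Q of e_LJ(Q)
(shared item 0629, same signature: finite blocks of Q plus far-away extras, boundary O(N^{2/3}), r⁻⁶
tail summable in d = 3; le_ciInf needs only Nonempty; coboundedness of the limsup from
BlancLewin2015_8_holds / lennardJones_stable_holds, both proved in tree). [difficulty: provable-now]
[BlancLewin2015]
#9 CrysPeriodicBddBelow (support) — the Lennard-Jones energy per particle of periodic configurations
of ℝ³ is bounded below (shared item 0714, same signature; finite blocks +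
lennardJones_stable_holds); makes ⨅_Q e(Q) a genuine infimum (ciInf_le) in the deciding theorem and
in CoerciveToDefectVanish. [difficulty: provable-now] [BlancLewin2015]
#9 BulkDefectVanish (support) — the shared HINGE (item 0751, a crux of PoissonBesselStacking /
LuttingerTiszaRegistry; here DERIVED from crux 3 by CoerciveToDefectVanish, hence support): one
periodic P such that for every R, ε, along every sequence of LJ ground states all but o(N) particles
have their R-neighbourhood ε-matched both ways to x_i + A(P.points ∩ B_R) for some linear isometry
A. [difficulty: open-problem] [BlancLewin2015, Hales2012]
#9 CoerciveToDefectVanish (support) — glue, provable now: CoerciveVarianceCertificate →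
CrysEnergyUpper → CrysPeriodicBddBelow → BulkDefectVanish. Proof: take P, C from crux 3; for a
ground-state sequence x and N ≥ 2 put D_N = CΣt − Σs² ≥ c·#bad_N ≥ 0; the algebra of
CertificateBoundsEnergy kept with D gives E(N) = 𝓔(x N) ≥ −NC/24 + N·D_N/(24Σt), so D_N ≤
24Σt(E(N)/N − e(P)); minimal distance δ (LennardJonesMinimalDistance_holds, or
Yuhjtman2015_minDistance_holds δ = 0.684) with sum_inv_pow_six_le gives t_i ≤ 250δ⁻¹², so #bad_N/N ≤
(24·250δ⁻¹²/c)(E(N)/N − e(P)); D_N ≥ 0 gives E(N)/N ≥ e(P), BlancLewin2015_8_holds + CrysEnergyUpper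
(Tendsto.limsup_eq) + ciInf_le give E(N)/N → e(P); squeeze. [difficulty: provable-now]
[BlancLewin2015, Yuhjtman2015]
#9 DefectVanishCrystallizes (support) — the shared SOFT ASSEMBLY LEMMA (item 0752, same signature):
BulkDefectVanish together with the uniform minimal distance of LJ ground states implies
IsCrystallizing lennardJones 3 (pick good particles i_k for R_k = k, ε_k = 1/k, τ_k = −x_{i_k},
extract A_k → A in O(3); minimal distance + discreteness of P make the ε-matching a local bijection;
A(P) is again periodic, multiplicity m ≡ 1; PeriodicConfiguration.tendsto_sum_of_eventually_near' in
CrystallizationLocalLimit.lean is the limit step). [difficulty: M] [BlancLewin2015, Xue1997]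

TWO-LAYER PLAN. Foreseen glued splits (nothing filed now). VarianceCertificate ⇐
NearFieldTransferCertificate → FarFieldAccountant → VarianceCertificate:
(near) for configurations normalised to local minimal distance 1, an explicit one-parameter
isometry-equivariant transfer τ (crowded pairs
r_jk ≤ κ·min(r_ij, r_ik) donate θ·r_jk⁻¹² to common near neighbours) with s_i^{≤R}·(s_i^{≤R} + 2F_i)
≤ Φ*·τ_i certified by interval
branch-and-bound over R-environments, (far) an exact positive-type accountant F_i for the r⁻⁶ tail
beyond R (a sup bound is false at hcp
itself, zero slack). CoerciveVarianceCertificate ⇐ LocalDeficitRigidity (deficit density small on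
B_R ⇒ shells η-close to twelve-at-a and
Barlow-stacked: the line's contribution to SoftTwelveCoordination 0750) → StackingDeficit (fcc-type
windows carry deficit ≥ (Φ_hcp −
Φ_fcc)·t ≈ 0.02 per site, via BarlowStackingEnergy / items 0716, 0737) →
CoerciveVarianceCertificate. PlanarVarianceCertificate ⇐
pointwise-with-one-transfer planar inequality → summation. GroundStateVarianceCertificate may
alternatively close from VarianceCertificate
(one line) or from CoerciveVarianceCertificate (c = 0; both checked in Sketch.lean).

KILL CRITERIA. A finite configuration (any N) with Σs²/Σt > 17.2225 (≥ Φ of relaxed hcp; candidates: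
Cambridge Cluster Database LJ minima N ≤ 1610,
Frank–Kasper approximants, modulated close packings, halo-decorated hcp blocks) refutes
VarianceCertificate; if it is (close to) a
Lennard-Jones ground state it refutes GroundStateVarianceCertificate and CoerciveVarianceCertificate
too and the route is closed
`refuted:GroundStateVarianceCertificate` (the PR framework then survives only as 2PR/N ≤ Φ*, i.e.
conjunct (i) restated — not a route).
A configuration with 2PR/N > 17.2225 refutes conjunct (i) for hcp outright (hand the witness to the
negative side). CoerciveVarianceCertificate
refuted with GroundStateVarianceCertificate standing (e.g. a second, non-isometric periodic
minimiser, or no uniform c) ⇒ repair by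
re-importing the shared positional item CrysPositional 0625 in place of the coercive chain (route
keeps (i)). LatticeQuotientBound refuted by
a lattice beating hcp ⇒ pivot all witnesses to that structure (the ∃P cruxes survive).
PlanarVarianceCertificate refuted ⇒ the transfer
mechanism is dead in its easiest habitat: close unless crux 2 has independent progress.
HcpPeriodicMinimiser (3061) + CrysEnergyLimit
(0626) proved elsewhere moot the (i)-side novelty but not the certificate.

NOT DECOMPOSED YET. The transfer rule (θ, κ), the cut-off R and the far-field accountant (layer-2
children of VarianceCertificate); the local rigidity and
stacking-deficit halves of CoerciveVarianceCertificate and any quantitative rate c(R,ε); hcp-vs-fcc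
inside the certificate (the ∃P form
deliberately leaves the 1e-4 stacking selection to items 0716/0737 and route PoissonBesselStacking);
the Mie (2p,p) participation ladder and
its p = ∞ kissing-number anchor (SchutteVanderwaerden1952; a separate thesis if pursued);
BddBelow/upper-bound supports are shared items,
not re-decomposed here.

CHEAPEST FALSIFIER. Evaluate Ψ = Σ_i s_i²/Σ_i t_i (two inverse-power sums per site, no optimisation)
on (a) the putative LJ global minima N ≤ 1610 of the
Cambridge Cluster Database, (b) LJ-relaxed periodic competitors (dhcp, 9R, Frank–Kasper
A15/σ/C14/C15/Z, bcc–fcc Bain path) and (c) hcp/fcc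
supercells with random displacements relaxed under the hinge Hamiltonian H = Σ_i[17.2225·t_i − s_i²]
by gradient ascent of Ψ, plus halo
decorations of hcp blocks at r ∈ [1.1, 1.4]: any value above 17.2225 kills crux 4 (and cruxes 2–3 if
the configuration is a ground state).
Already run (gen-1 planner + route reviewer, pure Python): perfect structures hcp 17.2222, fcc
17.2204, bcc 16.47, σ 15.76, A15 15.15,
C15 14.43; frozen-phonon second variation negative definite at fcc/hcp/triangular (worst Var/deficit
ratio 0.71); hill-climbs max Ψ =
10.28 (N ≤ 38, 3-D), 6.405 (N = 127, 2-D); triangular patches 6.56 at N = 931 with halo gain ≤ +0.02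
— all below Φ*. This session
re-computed L₆, L₁₂: fcc 14.4539/12.1319 (Φ 17.2204), hcp 14.4549/12.1323 (Φ 17.2222, c/a-relaxation
gain < 1e-4), triangular
6.3759/6.0098 (Φ 6.7642).

NUMBERS. Φ(hcp) = L₆²/L₁₂ = 14.4549²/12.1323 = 17.2222 (e = −Φ/24 = −0.71759); Φ(fcc) =
14.4539²/12.1319 = 17.2204; bcc 16.474; sc 11.382;
σ-phase 15.759 (variance term 0.038); A15 15.153; C15 14.433; 2-D triangular Φ_tri = 6.3759²/6.0098
= 6.7642. Identity Ψ(X) =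
2PR(X)/N + Var_X(s)/mean_X(t). Known one-centre LJ lower bound: stability constant ≤ 14.316 vs
conjectured 8.61 (Yuhjtman2015, in tree as
Yuhjtman2015_stabilityConstant_holds); minimal distance 0.684 (Yuhjtman2015_minDistance_holds). LJ
cluster optima: −12E(N)/N = PR/N = 3.41
(13), 5.08 (55), 5.96 (147) ↑ 8.611. Deficit bookkeeping: E(N) − N·e(P) ≥ N·D/(24Σt) ≈ D/290 for
ground states; an fcc-stacked bulk has
D ≈ (Φ_hcp − Φ_fcc)·Σt ≈ 0.022·N. Items at open: 12 (5 cruxes, 6 support, assembly).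

DEFINITION REQUESTS. None: siteEnergy, interactionEnergy, groundStateEnergy, IsGroundState,
PeriodicConfiguration.energyPerParticle/points,
hcpPeriodicConfiguration, IsCrystallizing, LennardJonesMinimalDistance, lennardJones all exist
(Literature.MathematicalPhysics.StatisticalMechanics); s_i, t_i are siteEnergy of r ↦ r⁻⁶, r ↦ r⁻¹².

Novelty: Searches (2026-08-15, this session): `lit search --source crossref "Lennard-Jones stability constant
lower bound ground state energy
clusters"` (14: Blanc2004 doi:10.1023/b:coap.0000039486.97389.87, van de Waal 1989, Northby 1989 —
cluster numerics / one-centre bounds);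
`lit search --source zbmath "Lennard-Jones lattice energy minimization"` (15: Theil2006,
BeterminZhang2015, Betermin2023 arXiv:2104.09795,
Luo–Wei arXiv:2212.10727, Schachinger–Addis–Bomze–Schoen 2007 doi:10.1007/s10589-007-9051-y,
Bétermin–Petrache 2019); `lit frontier
AtomisticToContinuum --since 2020` (30 rows; relevant: arXiv:2605.07580 'On ratios of theta
functions' — read pp. 1–8: Thms 1.1–1.3
classify extremisers of θ- and ζ/θ^k-ratios over 2-D unimodular lattices, hexagonal;
arXiv:2407.20762, arXiv:2604.19239 on the (ii) side);
`lit galaxy search "crystallization conjecture" --star all` (12: Oberwolfach report 49/2018,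
Kubin–Ponsiglione arXiv:2004.06820,
Cohn–Kumar–Miller–Radchenko–Viazovska) and `"Lennard-Jones stability constant" --star all` (0);
local hybrid index returned vector-only
noise; OpenAlex 429. Plus the audited searches of the two cards and of the gen-1 route
(crossref/galaxy for the quotient and the transfer).
Nearest prior art found: LennardJonesIngham1925 / KiharaKoba1952 (scale-free quotient A₆²/A₁₂ for
lattices), Yuhjtman2015 (one-centre
stability constant 14.316 with a minimal-distance input; formalised in tree), Hales2012 (score
transfers), BeterminSamajTravenec2022 /
Betermin2023  [refs: 10.1023/b:coap.0000039486.97389.87, 10.1007/s10589-007-9051-y, 2104.09795, 2212.10727, 2605.07580, 2407.20762, 2604.19239, 2004.06820, doi:10.1023/b, doi:10.1007/s10589-007-9051-y, Blanc2004, Theil2006, BeterminZhang2015, Betermin2023, LennardJonesIngham1925, KiharaKoba1952, Yuhjtman2015, Hales2012, BeterminSamajTravenec2022]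

Barriers (technique_class: participation-ratio cs-transfer-certificate variance-form): - technique_class: participation-ratio cs-transfer-certificate variance-form
- Literature.Barriers.AtomisticToContinuum.TetrahedralFrustration: APPLIES to any pointwise
(transfer-free) version — s_i²/t_i is unbounded (n equidistant crowded neighbours give n; far halos
give more) and polytetrahedral centres are local debtors; evaded only in the summed form, where
crowded pairs carry r⁻¹²-mass that pays for the centre (TCP bulk phases sit at Ψ ≤ 15.8 ≪ 17.2;
Bergman-type centre debt ≈ 6 vs first-shell credit ≈ 96); the bet is that ONE equivariant transfer
realises this, and the Rogers/dodecahedral non-sharpness does not transfer because Ψ is not a cell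
functional.
- Literature.Barriers.AtomisticToContinuum.IcosahedralClusters: consistent — finite LJ optima are
icosahedral but have Ψ far below Φ* (2PR/N = 6.8 at N = 13; maximised Ψ ≤ 10.3 for N ≤ 38); the
certificate is an inequality valid at every N, not a claim that clusters are crystal fragments, and
the coercive form counts ALL sites of a small cluster as defects consistently (D ≈ Σt(Φ* − Ψ) ≫ c·N
there).
- Literature.Barriers.AtomisticToContinuum.FlexibleKissingArrangements: not met — no single-shell
pattern inference; the coercive form sees whole R-windows through s and t and the matching is metric
(ε-congruence), not combinatorial.
- Literature.Barriers.AtomisticToContinuum.KissingTwelveDegeneracy: conceded at the resolution 1e-4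
— Φ(hcp) − Φ(fcc) = 1.8e-3 absolute; the ∃P form of cruxes 2, 4–6 does not need to separate s

History (route lifecycle, newest last):
- 2026-08-23T20:58:26Z · DORMANT — reconciler: no traction for 6.2 d (last activity item-evidence-added at 2026-08-17T14:34:45Z); parked, not closed — `ledger route dormant route-AtomisticToConti (operator:999:2245700)
- 2026-08-31T10:55:35Z · REACTIVATED (open) — reconciler: reactivated — activity statement-checked at 2026-08-31T09:44:27Z after parking at 2026-08-23T20:58:26Z (operator:999:1789158)

sub-problem: Crystallization · status: open · opened planner-plancard-AtomisticToContinuum-Crystal-c2a496bb-g2-0 2026-08-15T18:45:00Z · rev 1 · ledger route-AtomisticToContinuum-PRVarianceCertificate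
GENERATED by the gate from the ledger (D-0016/17). Provers cite these decls: `theorem foo : Summit.AtomisticToContinuum.Crystallization.Theses.PRVarianceCertificate.<Decl> := …` in Summits/AtomisticToContinuum/Crystallization/Theorems/<Name>.lean.
-/

namespace Summit.AtomisticToContinuum.Crystallization.Theses.PRVarianceCertificate

open scoped BigOperators Topology Manifold Classical MeasureTheory ProbabilityTheory Matrix InnerProductSpace ComplexConjugate ContinuousMap
open Filter Set Function TopologicalSpace MeasureTheory

attribute [summit_statement] _root_.Crystallization

/-- item stmt-AtomisticToContinuum-11859 · crux · rank 2 · open · by planner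
why it might fail: Ψ = 2PR/N + Var(s)/mean(t) is stronger than (i) by the site-variance term: a ground-state family whose variance beats its PR deficit (phonon margin only 0.29; a non-vertex-transitive periodic minimiser) refutes it even if hcp is the LJ crystal.
sources: Yuhjtman2015, BlancLewin2015, LennardJonesIngham1925, Stillinger2001, BeterminSamajTravenec2022, Literature.Barriers.AtomisticToContinuum.TetrahedralFrustration
[crux] there are a periodic configuration P of ℝ³ and C > 0 with e_LJ(P) ≤ −C/24 such that every
Lennard-Jones ground state x of N particles satisfies Σ_i s_i(x)² ≤ C·Σ_i t_i(x) (card item X_G in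
its logically equivalent weight-free form; intended P = relaxed hcp, C = Φ(hcp) = L₆²/L₁₂ ≈ 17.222;
forces e(P) = −C/24 = min over periodic configurations and E(N) ≥ N·e(P) for every N). [difficulty:
open-problem] -/
@[route_item "route-AtomisticToContinuum-PRVarianceCertificate", crux]
def GroundStateVarianceCertificate : Prop :=
  ∃ (P : Literature.MathematicalPhysics.StatisticalMechanics.PeriodicConfiguration 3) (C : ℝ), 0 < C ∧ P.energyPerParticle Literature.MathematicalPhysics.StatisticalMechanics.lennardJones ≤ -(C / 24) ∧ ∀ (N : ℕ) (x : Fin N → EuclideanSpace ℝ (Fin 3)), Literature.MathematicalPhysics.StatisticalMechanics.IsGroundState Literature.MathematicalPhysics.StatisticalMechanics.lennardJones x → ∑ i, (Literature.MathematicalPhysics.StatisticalMechanics.siteEnergy (fun r => (r⁻¹) ^ 6) x i) ^ 2 ≤ C * ∑ i, Literature.MathematicalPhysics.StatisticalMechanics.siteEnergy (fun r => (r⁻¹) ^ 12) x i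

/-- item stmt-AtomisticToContinuum-11860 · crux · rank 3 · open · by planner
why it might fail: needs uniqueness of the periodic minimiser up to isometry AND a uniform rate: unmatched sites with zero local deficit (uniformly strained grains, scale drift — Ψ is dilation-blind; sites within R of the surface when N ≲ ρR³) must be paid by distant deficit with one c(R,ε) for all N.
sources: BlancLewin2015, Hales2012, FlatleyTheil2015, PartayOrtnerCsanyi2017, Stillinger2001, Literature.Barriers.AtomisticToContinuum.KissingTwelveDegeneracy
[crux] the coercive (defect-counting) form, = X of the thesis: ∃ P, C > 0 with e_LJ(P) ≤ −C/24 such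
that ∀ R, ε > 0 ∃ c > 0: for every LJ ground state x of N ≥ 2 particles, c·#{i : no linear isometry
A makes the particles of B_R(x_i) ε-match x_i + A(P.points ∩ B_R) both ways} ≤ C·Σ_i t_i − Σ_i s_i²
(the matching predicate is verbatim that of the shared hinge BulkDefectVanish, item 0751; card item
(4) 'strictness'). [deps: GroundStateVarianceCertificate] [difficulty: open-problem] -/
@[route_item "route-AtomisticToContinuum-PRVarianceCertificate", crux]
def CoerciveVarianceCertificate : Prop :=
  ∃ (P : Literature.MathematicalPhysics.StatisticalMechanics.PeriodicConfiguration 3) (C : ℝ), 0 < C ∧ P.energyPerParticle Literature.MathematicalPhysics.StatisticalMechanics.lennardJones ≤ -(C / 24) ∧ ∀ R ε : ℝ, 0 < R → 0 < ε → ∃ c : ℝ, 0 < c ∧ ∀ (N : ℕ) (x : Fin N → EuclideanSpace ℝ (Fin 3)), Literature.MathematicalPhysics.StatisticalMechanics.IsGroundState Literature.MathematicalPhysics.StatisticalMechanics.lennardJones x → 2 ≤ N → c * (Nat.card {i : Fin N // ¬ ∃ A : EuclideanSpace ℝ (Fin 3) →ₗᵢ[ℝ] EuclideanSpace ℝ (Fin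 3), (∀ p ∈ P.points, ‖p‖ ≤ R → ∃ j : Fin N, dist (x j) (x i + A p) ≤ ε) ∧ (∀ j : Fin N, dist (x j) (x i) ≤ R → ∃ p ∈ P.points, dist (x j) (x i + A p) ≤ ε)} : ℝ) ≤ C * ∑ i, Literature.MathematicalPhysics.StatisticalMechanics.siteEnergy (fun r => (r⁻¹) ^ 12) x i - ∑ i, (Literature.MathematicalPhysics.StatisticalMechanics.siteEnergy (fun r => (r⁻¹) ^ 6) x i) ^ 2

/-- item stmt-AtomisticToContinuum-11861 · crux · rank 4 · open · by planner
why it might fail: adding far 'halo' points raises Ψ (marginal ratio ≈ s̄·r⁶ ≫ Φ*): an engineered multi-scale configuration (hovering shells at r ≈ 1.2, interfaces of two densities) might push Σs²/Σt above Φ(hcp) though no ground state does; refuter halo tests recovered ≤ 20 % of the surface deficit.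
sources: LennardJonesIngham1925, KiharaKoba1952, Yuhjtman2015, BlancLewin2015, Literature.Barriers.AtomisticToContinuum.IcosahedralClusters
[crux] the same certificate for EVERY finite configuration of distinct points of ℝ³ (scale-free, no
minimal-distance or ground-state input): ∃ P, C > 0, e_LJ(P) ≤ −C/24 ∧ ∀ injective x, Σ_i s_i² ≤
C·Σ_i t_i; equivalently sup_X Σs²/Σt is attained, in the limit, by a periodic configuration. This is
the natural target of a local isometry-equivariant transfer rule (the rule cannot see whether x is a
ground state) and implies crux 2 trivially. [difficulty: open-problem] -/
@[route_item "route-AtomisticToContinuum-PRVarianceCertificate"]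
def VarianceCertificate : Prop :=
  ∃ (P : Literature.MathematicalPhysics.StatisticalMechanics.PeriodicConfiguration 3) (C : ℝ), 0 < C ∧ P.energyPerParticle Literature.MathematicalPhysics.StatisticalMechanics.lennardJones ≤ -(C / 24) ∧ ∀ (N : ℕ) (x : Fin N → EuclideanSpace ℝ (Fin 3)), Function.Injective x → ∑ i, (Literature.MathematicalPhysics.StatisticalMechanics.siteEnergy (fun r => (r⁻¹) ^ 6) x i) ^ 2 ≤ C * ∑ i, Literature.MathematicalPhysics.StatisticalMechanics.siteEnergy (fun r => (r⁻¹) ^ 12) x i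

/-- item stmt-AtomisticToContinuum-11862 · crux · rank 5 · open · by planner
why it might fail: same variance strengthening in d = 2 (long-wave phonon ratio Var/deficit = 2/3, margin 1/3); triangular patches give Ψ = 6.56 at N = 931 (refuter) vs Φ_tri = 6.764 and halos add +0.02: a large decorated cluster could still cross Φ_tri.
sources: Theil2006, BeterminZhang2015, Betermin2023, arXiv:2605.07580, BlancLewin2015, Literature.Barriers.AtomisticToContinuum.LocalizedPotentialsExcludeLennardJones
[crux] the planar rung: ∃ P : PeriodicConfiguration 2 (intended: triangular lattice, Φ_tri = L₆²/L₁₂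
= 6.3759²/6.0098 = 6.7642), C > 0, e_LJ(P) ≤ −C/24 ∧ ∀ finite injective x ⊂ ℝ², Σ_i s_i² ≤ C·Σ_i
t_i. Gives conjunct (i) for the TRUE (12,6) potential in d = 2 (outside Theil2006's hypotheses); the
Bravais slice is BeterminZhang2015; the hexagon is a rigid kissing configuration, so this is where a
transfer-free or one-transfer proof should exist if the mechanism is real. [difficulty: L] -/
@[route_item "route-AtomisticToContinuum-PRVarianceCertificate"]
def PlanarVarianceCertificate : Prop :=
  ∃ (P : Literature.MathematicalPhysics.StatisticalMechanics.PeriodicConfiguration 2) (C : ℝ), 0 < C ∧ P.energyPerParticle Literature.MathematicalPhysics.StatisticalMechanics.lennardJones ≤ -(C / 24) ∧ ∀ (N : ℕ) (x : Fin N → EuclideanSpace ℝ (Fin 2)), Function.Injective x → ∑ i, (Literature.MathematicalPhysics.StatisticalMechanics.siteEnergy (fun r => (r⁻¹) ^ 6) x i) ^ 2 ≤ C * ∑ i, Literature.MathematicalPhysics.StatisticalMechanics.siteEnergy (fun r => (r⁻¹) ^ 12) x i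

/-- item stmt-AtomisticToContinuum-11863 · crux · rank 6 · open · by planner
why it might fail: asserts two numerically-known but unproved facts at once: fcc maximises L₆²/L₁₂ among 3-D Bravais lattices (BeterminSamajTravenec2022 numerics) and hcp beats fcc (Φ 17.2222 vs 17.2204, relative margin 1.0e-4, Stillinger2001); a non-cubic lattice inside that margin kills it.
sources: BeterminSamajTravenec2022, Stillinger2001, SchwerdtfegerBurrowsSmits2021, KiharaKoba1952, arXiv:2212.10727, Literature.Barriers.AtomisticToContinuum.NoUniversallyOptimalLattice3D
[crux] the variance-free Bravais slice, pinned to hcp: there are a, h ≠ 0 such that for every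
Bravais lattice L of ℝ³ (periodic configuration with one-point motif) L₆(L)² ≤
(−24·e_LJ(hcp_{a,h}))·L₁₂(L), i.e. no Bravais lattice at any density beats relaxed hcp for
Lennard-Jones (expected max_L L₆²/L₁₂ = Φ(fcc) = 17.2204 < 17.2222 = Φ(hcp); certified lattice sums
+ a 5-parameter optimisation over lattice shapes with cusp asymptotics, the ratio analogue of
Betermin2023 / arXiv:2605.07580 one dimension up). [difficulty: M] -/
@[route_item "route-AtomisticToContinuum-PRVarianceCertificate"]
def LatticeQuotientBound : Prop :=
  ∃ (a h : ℝ) (ha : a ≠ 0) (hh : h ≠ 0), ∀ Q : Literature.MathematicalPhysics.StatisticalMechanics.PeriodicConfiguration 3, Q.motif.card = 1 → 2 * (Q.energyPerParticle (fun r => (r⁻¹) ^ 6)) ^ 2 ≤ (-(24 : ℝ) * (Literature.MathematicalPhysics.StatisticalMechanics.hcpPeriodicConfiguration ha hh).energyPerParticle Literature.MathematicalPhysics.StatisticalMechanics.lennardJones) * Q.energyPerParticle (fun r => (r⁻¹) ^ 12)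

/-- item stmt-AtomisticToContinuum-0714 · support · rank 9 · closed · proved by Summit.AtomisticToContinuum.Crystallization.Theorems.crysPeriodicBddBelow_proof (prover) · by planner
sources: BlancLewin2015
The Lennard-Jones energy per particle of periodic configurations of ℝ³ (any full-rank lattice, any
finite motif) is bounded below (by −B, the stability constant: finite blocks of Q as N-point
configurations, boundary O(N^{2/3}), r⁻⁶ tail summable in d = 3). Makes ⨅_Q e(Q) a genuine infimum
(ciInf_le usable) in 0626/0629 and in the periodisation lemma. -/
@[route_item "route-AtomisticToContinuum-PRVarianceCertificate", crux]
def CrysPeriodicBddBelow : Prop :=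
  BddBelow (Set.range fun Q : Literature.MathematicalPhysics.StatisticalMechanics.PeriodicConfiguration 3 => Q.energyPerParticle Literature.MathematicalPhysics.StatisticalMechanics.lennardJones)

/-- `CrysPeriodicBddBelow` holds: proved by `Summit.AtomisticToContinuum.Crystallization.Theorems.crysPeriodicBddBelow_proof`. -/
theorem CrysPeriodicBddBelow_holds : CrysPeriodicBddBelow := _root_.Summit.AtomisticToContinuum.Crystallization.Theorems.crysPeriodicBddBelow_proof

/-- item stmt-AtomisticToContinuum-0751 · support · rank 9 · open · by planner
sources: BlancLewin2015, Hales2012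
[crux] HINGE: there is ONE periodic configuration P (the LJ-optimal HCP-type stacking, 0 ∈ motif)
such that for every window radius R and tolerance ε, in every sequence of LJ ground states all but
o(N) particles i admit a linear isometry A with the particles in B_R(x_i) ε-matched both ways to x_i
+ A(P.points ∩ B_R). Follows from (K1) SoftTwelveCoordination + (K2) RobustFejesTothHales + (K3)
stacking selection (Hägg domination 0716/0737 + certified J_k) with ≤ K fault planes per ground
state. Sources: Hales2012 Thm 1; HaggStacking.lean; PartayOrtnerCsanyi2017. -/
@[route_item "route-AtomisticToContinuum-PRVarianceCertificate"]
def BulkDefectVanish : Prop :=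
  ∃ P : Literature.MathematicalPhysics.StatisticalMechanics.PeriodicConfiguration 3, ∀ R ε : ℝ, 0 < R → 0 < ε → ∀ x : (N : ℕ) → (Fin N → EuclideanSpace ℝ (Fin 3)), (∀ N, Literature.MathematicalPhysics.StatisticalMechanics.IsGroundState Literature.MathematicalPhysics.StatisticalMechanics.lennardJones (x N)) → Filter.Tendsto (fun N : ℕ => (Nat.card {i : Fin N // ¬ ∃ A : EuclideanSpace ℝ (Fin 3) →ₗᵢ[ℝ] EuclideanSpace ℝ (Fin 3), (∀ p ∈ P.points, ‖p‖ ≤ R → ∃ j : Fin N, dist (x N j) (x N i + A p) ≤ ε) ∧ (∀ j : Fin N, dist (x N j) (x N i) ≤ R → ∃ p ∈ P.points, dist (x N j) (x N i + A p) ≤ ε)} : ℝ) / N) Filter.atTop (nhds 0)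

/-- item stmt-AtomisticToContinuum-0752 · support · rank 9 · closed · proved by Summit.AtomisticToContinuum.Crystallization.Theorems.ThreeConeCertificateDefectVanishCrystallizes.defectVanishCrystallizes_proof (prover) · by planner
sources: BlancLewin2015, Xue1997
[support] SOFT ASSEMBLY LEMMA: BulkDefectVanish together with the uniform minimal distance of LJ
ground states (Literature fact LennardJonesMinimalDistance, Xue 1997 / BlancLewin2015 §2.2) implies
IsCrystallizing lennardJones 3: pick, for R_k = k, ε_k = 1/k, indices N_k ↑ and good particles i_k;
τ_k = −x_{i_k}; extract a convergent subsequence of the isometries A_k → A in O(3); minimal distance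
+ discreteness of P make the ε-matching a local bijection, so Σ_i f(x_i + τ_k) → Σ_{s ∈ A(P.points)}
f(s) for f ∈ C_c; A(P) is again a PeriodicConfiguration (rotate lattice and motif), multiplicity m ≡
1. -/
@[route_item "route-AtomisticToContinuum-PRVarianceCertificate", crux]
def DefectVanishCrystallizes : Prop :=
  BulkDefectVanish → Literature.MathematicalPhysics.StatisticalMechanics.LennardJonesMinimalDistance → Literature.MathematicalPhysics.StatisticalMechanics.IsCrystallizing Literature.MathematicalPhysics.StatisticalMechanics.lennardJones 3

/-- `DefectVanishCrystallizes` holds: proved by `Summit.AtomisticToContinuum.Crystallization.Theorems.ThreeConeCertificateDefectVanishCrystallizes.defectVanishCrystallizes_proof`. -/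
theorem DefectVanishCrystallizes_holds : DefectVanishCrystallizes := _root_.Summit.AtomisticToContinuum.Crystallization.Theorems.ThreeConeCertificateDefectVanishCrystallizes.defectVanishCrystallizes_proof

/-- item stmt-AtomisticToContinuum-11864 · support · rank 9 · closed · proved by Summit.AtomisticToContinuum.Crystallization.Theorems.certificateBoundsEnergy_proof @ 3a47a3d98f48 (prover) · by planner
sources: LennardJonesIngham1925, BlancLewin2015
[support] Cauchy–Schwarz + dilation, pure algebra in any dimension: if 0 ≤ C and Σ_i s_i² ≤ C·Σ_i
t_i for an injective configuration x of N points, then interactionEnergy lennardJones x ≥ −(C/24)·N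
(with A = Σ_{i<j} r⁻⁶ = ½Σs_i, B = Σ_{i<j} r⁻¹² = ½Σt_i: E = B/12 − A/6 = (B − A)²/(12B) − A²/(12B)
≥ −A²/(12B) and (Σs_i)² ≤ N·Σs_i² ≤ N·C·Σt_i; N ≤ 1 is 0 ≤ 0; two_mul_interactionEnergy in tree).
[difficulty: provable-now] -/
@[route_item "route-AtomisticToContinuum-PRVarianceCertificate", crux]
def CertificateBoundsEnergy : Prop :=
  ∀ (C : ℝ), 0 ≤ C → ∀ (d N : ℕ) (x : Fin N → EuclideanSpace ℝ (Fin d)), Function.Injective x → ∑ i, (Literature.MathematicalPhysics.StatisticalMechanics.siteEnergy (fun r => (r⁻¹) ^ 6) x i) ^ 2 ≤ C * ∑ i, Literature.MathematicalPhysics.StatisticalMechanics.siteEnergy (fun r => (r⁻¹) ^ 12) x i → -(C / 24 * N) ≤ Literature.MathematicalPhysics.StatisticalMechanics.interactionEnergy Literature.MathematicalPhysics.StatisticalMechanics.lennardJones x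

-- `CertificateBoundsEnergy` holds: proved by `Summit.AtomisticToContinuum.Crystallization.Theorems.certificateBoundsEnergy_proof` @ 3a47a3d98f48 (its module imports this route file, so no `_holds` link can be stated here).

/-- item stmt-AtomisticToContinuum-11865 · support · rank 9 · closed · proved by Summit.AtomisticToContinuum.Crystallization.Theorems.crysEnergyUpper_proof @ e4cec8285cc2 (prover) · by planner
sources: BlancLewin2015
[support] trial-state upper bound limsup E(N)/N ≤ ⨅ over periodic Q of e_LJ(Q) (shared item 0629,
same signature: finite blocks of Q plus far-away extras, boundary O(N^{2/3}), r⁻⁶ tail summable in d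
= 3; le_ciInf needs only Nonempty; coboundedness of the limsup from BlancLewin2015_8_holds /
lennardJones_stable_holds, both proved in tree). [difficulty: provable-now] -/
@[route_item "route-AtomisticToContinuum-PRVarianceCertificate", crux]
def CrysEnergyUpper : Prop :=
  Filter.limsup (fun N : ℕ => Literature.MathematicalPhysics.StatisticalMechanics.groundStateEnergy Literature.MathematicalPhysics.StatisticalMechanics.lennardJones 3 N / N) Filter.atTop ≤ ⨅ Q : Literature.MathematicalPhysics.StatisticalMechanics.PeriodicConfiguration 3, Q.energyPerParticle Literature.MathematicalPhysics.StatisticalMechanics.lennardJones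

/-- `CrysEnergyUpper` holds: proved by `Summit.AtomisticToContinuum.Crystallization.Theorems.crysEnergyUpper_proof` @ e4cec8285cc2. -/
theorem CrysEnergyUpper_holds : CrysEnergyUpper := _root_.Summit.AtomisticToContinuum.Crystallization.Theorems.crysEnergyUpper_proof

/-- item stmt-AtomisticToContinuum-11866 · support · rank 9 · closed · proved by Summit.AtomisticToContinuum.Crystallization.Theorems.coerciveToDefectVanish_proof @ aadedb270015 (prover) · by planner
sources: BlancLewin2015, Yuhjtman2015
[support] glue, provable now: CoerciveVarianceCertificate → CrysEnergyUpper → CrysPeriodicBddBelow →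
BulkDefectVanish. Proof: take P, C from crux 3; for a ground-state sequence x and N ≥ 2 put D_N =
CΣt − Σs² ≥ c·#bad_N ≥ 0; the algebra of CertificateBoundsEnergy kept with D gives E(N) = 𝓔(x N) ≥
−NC/24 + N·D_N/(24Σt), so D_N ≤ 24Σt(E(N)/N − e(P)); minimal distance δ
(LennardJonesMinimalDistance_holds, or Yuhjtman2015_minDistance_holds δ = 0.684) with
sum_inv_pow_six_le gives t_i ≤ 250δ⁻¹², so #bad_N/N ≤ (24·250δ⁻¹²/c)(E(N)/N − e(P)); D_N ≥ 0 gives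
E(N)/N ≥ e(P), BlancLewin2015_8_holds + CrysEnergyUpper (Tendsto.limsup_eq) + ciInf_le give E(N)/N →
e(P); squeeze. [difficulty: provable-now] -/
@[route_item "route-AtomisticToContinuum-PRVarianceCertificate", crux]
def CoerciveToDefectVanish : Prop :=
  CoerciveVarianceCertificate → CrysEnergyUpper → CrysPeriodicBddBelow → BulkDefectVanish

-- `CoerciveToDefectVanish` holds: proved by `Summit.AtomisticToContinuum.Crystallization.Theorems.coerciveToDefectVanish_proof` @ aadedb270015 (its module imports this route file, so no `_holds` link can be stated here).

/-- item stmt-AtomisticToContinuum-11867 · assembly · rank 1 · closed · proved by Summit.AtomisticToContinuum.Crystallization.Theorems.pRVarianceCertificate_assembly_proof @ 2161bfde1b9e (prover) · by planner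
sources: BlancLewin2015
[assembly] GroundStateVarianceCertificate → CertificateBoundsEnergy → CrysEnergyUpper →
CrysPeriodicBddBelow → CoerciveVarianceCertificate → CoerciveToDefectVanish →
DefectVanishCrystallizes → Crystallization (the same implication as a Prop; provable now by the
script of the deciding theorem). -/
@[route_item "route-AtomisticToContinuum-PRVarianceCertificate"]
def Assembly : Prop :=
  GroundStateVarianceCertificate → CertificateBoundsEnergy → CrysEnergyUpper → CrysPeriodicBddBelow → CoerciveVarianceCertificate → CoerciveToDefectVanish → DefectVanishCrystallizes → Crystallization

-- `Assembly` holds: proved by `Summit.AtomisticToContinuum.Crystallization.Theorems.pRVarianceCertificate_assembly_proof` @ 2161bfde1b9e (its module imports this route file, so no `_holds` link can be stated here).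

/-! D-0027 §2.1 — DECIDING THEOREM (planner-authored via `route open/edit --closes-file`; by planner-rrepair-AtomisticToContinuum-PRVarianc-3bdba961-0 2026-08-15T19:02:42Z):
its hypotheses are this route's items and its conclusion the sub-problem Statement (glue_lint), and it elaborates with this file. -/

@[closes "route-AtomisticToContinuum-PRVarianceCertificate"] theorem closes : GroundStateVarianceCertificate → CoerciveVarianceCertificate → CertificateBoundsEnergy → CrysEnergyUpper → CrysPeriodicBddBelow → CoerciveToDefectVanish → DefectVanishCrystallizes → _root_.Crystallization := by
  intro hGS hCo hCBE hUp hBdd hCTDV hDVC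
  change Literature.MathematicalPhysics.StatisticalMechanics.HasPeriodicGroundStateEnergy
      Literature.MathematicalPhysics.StatisticalMechanics.lennardJones 3 ∧
    Literature.MathematicalPhysics.StatisticalMechanics.IsCrystallizing
      Literature.MathematicalPhysics.StatisticalMechanics.lennardJones 3
  -- conjunct (ii): coercive certificate ⟹ (glue) bulk defects vanish ⟹ (soft assembly) crystallization
  refine ⟨?_, hDVC (hCTDV hCo hUp hBdd)
    Literature.MathematicalPhysics.StatisticalMechanics.LennardJonesMinimalDistance_holds⟩
  -- conjunct (i): the certificate pins lim E(N)/N to e(P) and makes e(P) the periodic minimum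
  obtain ⟨P, C, hC, heP, hcert⟩ := hGS
  -- Lennard-Jones ground states exist for every N (proved Literature fact)
  choose x hx using
    (show ∀ N : ℕ, ∃ y : Fin N → EuclideanSpace ℝ (Fin 3),
        Literature.MathematicalPhysics.StatisticalMechanics.IsGroundState
          Literature.MathematicalPhysics.StatisticalMechanics.lennardJones y from
      Literature.MathematicalPhysics.StatisticalMechanics.LennardJonesGroundStatesExist_holds)
  -- lower bound E(N)/N ≥ e(P) for N ≥ 1, from the certificate and the Cauchy–Schwarz/dilation algebra
  have hlow : ∀ N : ℕ, 0 < N → P.energyPerParticle Literature.MathematicalPhysics.StatisticalMechanics.lennardJones ≤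
      Literature.MathematicalPhysics.StatisticalMechanics.groundStateEnergy
        Literature.MathematicalPhysics.StatisticalMechanics.lennardJones 3 N / N := by
    intro N hN
    have hN' : (0 : ℝ) < N := by exact_mod_cast hN
    have h1 := hCBE C hC.le 3 N (x N) (hx N).1 (hcert N (x N) (hx N))
    rw [le_div_iff₀ hN', ← (hx N).2]
    calc P.energyPerParticle Literature.MathematicalPhysics.StatisticalMechanics.lennardJones * N
        ≤ -(C / 24) * N := mul_le_mul_of_nonneg_right heP hN'.le
      _ = -(C / 24 * N) := by ring
      _ ≤ _ := h1
  -- E(N)/N converges (proved Literature fact, Blanc–Lewin (8))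
  obtain ⟨e, -, hlim, -⟩ :=
    Literature.MathematicalPhysics.StatisticalMechanics.BlancLewin2015_8_holds 3 (by norm_num) (by norm_num)
  have hge : P.energyPerParticle Literature.MathematicalPhysics.StatisticalMechanics.lennardJones ≤ e :=
    ge_of_tendsto hlim ((Filter.eventually_gt_atTop 0).mono fun N hN => hlow N hN)
  have hle : e ≤ ⨅ Q : Literature.MathematicalPhysics.StatisticalMechanics.PeriodicConfiguration 3,
      Q.energyPerParticle Literature.MathematicalPhysics.StatisticalMechanics.lennardJones := by
    have h0 : CrysEnergyUpper := hUp
    unfold CrysEnergyUpper at h0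
    rwa [hlim.limsup_eq] at h0
  have heq : e = P.energyPerParticle Literature.MathematicalPhysics.StatisticalMechanics.lennardJones :=
    le_antisymm (hle.trans (ciInf_le hBdd P)) hge
  refine ⟨P, ⟨⟨P, rfl⟩, ?_⟩, heq ▸ hlim⟩
  rintro _ ⟨Q, rfl⟩
  exact (hge.trans hle).trans (ciInf_le hBdd Q)

end Summit.AtomisticToContinuum.Crystallization.Theses.PRVarianceCertificate
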